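import Mathlib
import Summits.Ventures.PercRepro.TriangleCapFourRowThreeCap

/-!
# PercRepro — ADDING AN EDGE: the degrees, the edge count, `Σ_v d(v)²`, `K₄⁻`-freeness when the ends have no
common neighbour, and the sides (p3, gen 46; part 199s)

`D ⊔ edge u y` (Mathlib's `SimpleGraph.edge`) for a non-adjacent pair `u ≠ y`: `deg` grows by one at `u` and `y`
(`deg_sup_edge_left/right/other`), `Σ_v d(v)²` by `2 (d(u) + d(y)) + 2` (`sum_deg_sq_sup_edge`), the degree sum by two
(`sum_deg_sup_edge`, hence the edge count by one); if `u` and `y` have no common neighbour the new edge lies in no triangle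
and the graph stays `K₄⁻`-free (`k4mFree_sup_edge`: on a `4`-set containing `u, y` the old graph has at most `3`
edges — the `S`-neighbourhoods of `u` and `y` are disjoint inside the other two vertices, each of which sees at most
one of `u`, `y`); a side of `D ⊔ edge u y` is a side of `D` (`bipSub_of_le`). The tool of part 199t: a cap graph on
`(k, 4, 4)` with one triangle is a cap graph on `(k, 4, 3)` after one edge. Axioms: standard.
-/

namespace PercRepro

namespace TriangleCap

namespace C047

open Finset

variable {V : Type*} [Fintype V] [DecidableEq V]

omit [Fintype V] [DecidableEq V] in
/-- Adjacency in `D ⊔ edge u y`. -/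
theorem adj_sup_edge (D : SimpleGraph V) (u y a b : V) :
    (D ⊔ SimpleGraph.edge u y).Adj a b ↔ D.Adj a b ∨ ((a = u ∧ b = y ∨ a = y ∧ b = u) ∧ a ≠ b) := by
  rw [SimpleGraph.sup_adj, SimpleGraph.edge_adj]

omit [Fintype V] [DecidableEq V] in
/-- A side of `D ⊔ edge u y` is a side of `D`. -/
theorem bipSub_of_le (D : SimpleGraph V) (u y : V) (A : Finset V) (hB : BipSub (D ⊔ SimpleGraph.edge u y) A) :
    BipSub D A := fun a b hab => hB a b ((adj_sup_edge D u y a b).mpr (Or.inl hab))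

/-- The degree at `u` after adding the edge `u y` (`u ≠ y`, `u ≁ y`): `+ 1`. -/
theorem deg_sup_edge_left (D : SimpleGraph V) [DecidableRel D.Adj] (u y : V) (huy : u ≠ y) (hn : ¬ D.Adj u y) :
    deg (D ⊔ SimpleGraph.edge u y) u = deg D u + 1 := by
  unfold deg
  have : univ.filter (fun w => (D ⊔ SimpleGraph.edge u y).Adj u w) = insert y (univ.filter (fun w => D.Adj u w)) := by
    ext w
    rw [mem_insert, mem_filter, mem_filter, adj_sup_edge]
    constructor
    · rintro ⟨-, h | ⟨h, hne⟩⟩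
      · exact Or.inr ⟨mem_univ _, h⟩
      · rcases h with ⟨-, h2⟩ | ⟨h1, -⟩
        · exact Or.inl h2
        · exact absurd h1 huy
    · rintro (rfl | ⟨-, h⟩)
      · exact ⟨mem_univ _, Or.inr ⟨Or.inl ⟨rfl, rfl⟩, huy⟩⟩
      · exact ⟨mem_univ _, Or.inl h⟩
  rw [this, card_insert_of_notMem]
  rw [mem_filter]
  exact fun h => hn h.2

/-- The degree at `y` after adding the edge `u y`: `+ 1`. -/
theorem deg_sup_edge_right (D : SimpleGraph V) [DecidableRel D.Adj] (u y : V) (huy : u ≠ y) (hn : ¬ D.Adj u y) :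
    deg (D ⊔ SimpleGraph.edge u y) y = deg D y + 1 := by
  unfold deg
  have : univ.filter (fun w => (D ⊔ SimpleGraph.edge u y).Adj y w) = insert u (univ.filter (fun w => D.Adj y w)) := by
    ext w
    rw [mem_insert, mem_filter, mem_filter, adj_sup_edge]
    constructor
    · rintro ⟨-, h | ⟨h, hne⟩⟩
      · exact Or.inr ⟨mem_univ _, h⟩
      · rcases h with ⟨h1, -⟩ | ⟨-, h2⟩
        · exact absurd h1.symm huy
        · exact Or.inl h2
    · rintro (rfl | ⟨-, h⟩)
      · exact ⟨mem_univ _, Or.inr ⟨Or.inr ⟨rfl, rfl⟩, fun h => huy h.symm⟩⟩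
      · exact ⟨mem_univ _, Or.inl h⟩
  rw [this, card_insert_of_notMem]
  rw [mem_filter]
  exact fun h => hn (D.adj_symm h.2)

/-- The degree off `u, y` after adding the edge `u y`: unchanged. -/
theorem deg_sup_edge_other (D : SimpleGraph V) [DecidableRel D.Adj] (u y v : V) (hvu : v ≠ u) (hvy : v ≠ y) :
    deg (D ⊔ SimpleGraph.edge u y) v = deg D v := by
  unfold deg
  congr 1
  ext w
  rw [mem_filter, mem_filter, adj_sup_edge]
  constructor
  · rintro ⟨-, h | ⟨h, -⟩⟩
    · exact ⟨mem_univ _, h⟩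
    · rcases h with ⟨h1, -⟩ | ⟨h1, -⟩
      · exact absurd h1 hvu
      · exact absurd h1 hvy
  · rintro ⟨-, h⟩
    exact ⟨mem_univ _, Or.inl h⟩

/-- `Σ_v d(v)` after adding the edge `u y`: `+ 2`. -/
theorem sum_deg_sup_edge (D : SimpleGraph V) [DecidableRel D.Adj] (u y : V) (huy : u ≠ y) (hn : ¬ D.Adj u y) :
    ∑ v, deg (D ⊔ SimpleGraph.edge u y) v = ∑ v, deg D v + 2 := by
  have hyu : y ∈ univ.erase u := mem_erase.mpr ⟨huy.symm, mem_univ _⟩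
  have hsplit : ∀ f : V → ℕ, ∑ v, f v = f u + (f y + ∑ v ∈ (univ.erase u).erase y, f v) := by
    intro f
    rw [add_sum_erase _ _ hyu, add_sum_erase _ _ (mem_univ u)]
  rw [hsplit, hsplit (fun v => deg D v), deg_sup_edge_left D u y huy hn, deg_sup_edge_right D u y huy hn]
  have hrest : ∑ v ∈ (univ.erase u).erase y, deg (D ⊔ SimpleGraph.edge u y) v =
      ∑ v ∈ (univ.erase u).erase y, deg D v := by
    apply sum_congr rfl
    intro v hv
    rw [mem_erase, mem_erase] at hv
    rw [deg_sup_edge_other D u y v hv.2.1 hv.1]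
  rw [hrest]
  ring

/-- `Σ_v d(v)²` after adding the edge `u y`: `+ 2 (d(u) + d(y)) + 2`. -/
theorem sum_deg_sq_sup_edge (D : SimpleGraph V) [DecidableRel D.Adj] (u y : V) (huy : u ≠ y) (hn : ¬ D.Adj u y) :
    ∑ v, deg (D ⊔ SimpleGraph.edge u y) v * deg (D ⊔ SimpleGraph.edge u y) v =
      ∑ v, deg D v * deg D v + 2 * (deg D u + deg D y) + 2 := by
  have hyu : y ∈ univ.erase u := mem_erase.mpr ⟨huy.symm, mem_univ _⟩
  have hsplit : ∀ f : V → ℕ, ∑ v, f v = f u + (f y + ∑ v ∈ (univ.erase u).erase y, f v) := by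
    intro f
    rw [add_sum_erase _ _ hyu, add_sum_erase _ _ (mem_univ u)]
  rw [hsplit, hsplit (fun v => deg D v * deg D v), deg_sup_edge_left D u y huy hn, deg_sup_edge_right D u y huy hn]
  have hrest : ∑ v ∈ (univ.erase u).erase y, deg (D ⊔ SimpleGraph.edge u y) v * deg (D ⊔ SimpleGraph.edge u y) v =
      ∑ v ∈ (univ.erase u).erase y, deg D v * deg D v := by
    apply sum_congr rfl
    intro v hv
    rw [mem_erase, mem_erase] at hv
    rw [deg_sup_edge_other D u y v hv.2.1 hv.1]
  rw [hrest]
  ring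

omit [Fintype V] in
/-- **`K₄⁻`-FREENESS SURVIVES AN EDGE BETWEEN VERTICES WITHOUT A COMMON NEIGHBOUR:** on a `4`-set containing `u` and
`y` the old graph has at most `3` edges (`6` ordered pairs), so the new edge keeps every `4`-set at `≤ 8`. -/
theorem k4mFree_sup_edge (D : SimpleGraph V) [DecidableRel D.Adj] (hK : K4mFree D) (u y : V) (huy : u ≠ y)
    (hn : ¬ D.Adj u y) (hcommon : ∀ w, D.Adj u w → ¬ D.Adj y w) : K4mFree (D ⊔ SimpleGraph.edge u y) := by
  intro S hS
  have hsub : (S ×ˢ S).filter (fun p => (D ⊔ SimpleGraph.edge u y).Adj p.1 p.2) ⊆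
      (S ×ˢ S).filter (fun p => D.Adj p.1 p.2) ∪ {(u, y), (y, u)} := by
    intro p hp
    rw [mem_filter, adj_sup_edge] at hp
    rw [mem_union, mem_filter, mem_insert, mem_singleton]
    rcases hp.2 with h | ⟨h, -⟩
    · exact Or.inl ⟨hp.1, h⟩
    · rcases h with ⟨h1, h2⟩ | ⟨h1, h2⟩
      · exact Or.inr (Or.inl (Prod.ext h1 h2))
      · exact Or.inr (Or.inr (Prod.ext h1 h2))
  have hcard := card_le_card hsub
  have hpair : ({(u, y), (y, u)} : Finset (V × V)).card ≤ 2 := card_le_two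
  have h1 := card_union_le ((S ×ˢ S).filter (fun p => D.Adj p.1 p.2)) {(u, y), (y, u)}
  unfold adjPairs
  by_cases huS : u ∈ S ∧ y ∈ S
  · -- the old graph has at most `6` ordered adjacent pairs inside `S`
    have hyS' : y ∈ S.erase u := mem_erase.mpr ⟨huy.symm, huS.2⟩
    have hcard2 : ((S.erase u).erase y).card = 2 := by
      rw [card_erase_of_mem hyS', card_erase_of_mem huS.1, hS]
    have h6 : adjPairs D S ≤ 6 := by
      rw [adjPairs_eq_sum_degIn, ← add_sum_erase S _ huS.1, ← add_sum_erase (S.erase u) _ hyS']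
      -- `u` and `y`: disjoint `S`-neighbourhoods inside the other two vertices
      have huy2 : degIn D S u + degIn D S y ≤ 2 := by
        unfold degIn
        have hdisj : Disjoint (S.filter (fun s => D.Adj u s)) (S.filter (fun s => D.Adj y s)) := by
          rw [disjoint_left]
          intro s hs1 hs2
          rw [mem_filter] at hs1 hs2
          exact hcommon s hs1.2 hs2.2
        have hsub2 : S.filter (fun s => D.Adj u s) ∪ S.filter (fun s => D.Adj y s) ⊆ (S.erase u).erase y := by
          intro s hs
          rw [mem_union, mem_filter, mem_filter] at hs
          rw [mem_erase, mem_erase]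
          rcases hs with ⟨hsS, hus⟩ | ⟨hsS, hys⟩
          · exact ⟨fun h => hn (h ▸ hus), fun h => D.irrefl (h ▸ hus), hsS⟩
          · exact ⟨fun h => D.irrefl (h ▸ hys), fun h => hn (D.adj_symm (h ▸ hys)), hsS⟩
        have h := card_union_add_card_inter (S.filter (fun s => D.Adj u s)) (S.filter (fun s => D.Adj y s))
        rw [disjoint_iff_inter_eq_empty.mp hdisj, card_empty, add_zero] at h
        have := card_le_card hsub2
        omega
      -- the other two vertices: each sees at most one of `u`, `y`, so at most `2` inside `S`
      have hrest : ∀ t ∈ (S.erase u).erase y, degIn D S t ≤ 2 := by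
        intro t ht
        rw [mem_erase, mem_erase] at ht
        unfold degIn
        by_cases htu : D.Adj t u
        · have hty : ¬ D.Adj t y := fun h => hcommon t (D.adj_symm htu) (D.adj_symm h)
          have hsub3 : S.filter (fun s => D.Adj t s) ⊆ (S.erase t).erase y := by
            intro s hs
            rw [mem_filter] at hs
            rw [mem_erase, mem_erase]
            exact ⟨fun h => hty (h ▸ hs.2), fun h => D.irrefl (h ▸ hs.2), hs.1⟩
          have := card_le_card hsub3
          have hc : ((S.erase t).erase y).card = 2 := by
            rw [card_erase_of_mem (mem_erase.mpr ⟨ht.1.symm, huS.2⟩), card_erase_of_mem ht.2.2, hS]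
          omega
        · have hsub3 : S.filter (fun s => D.Adj t s) ⊆ (S.erase t).erase u := by
            intro s hs
            rw [mem_filter] at hs
            rw [mem_erase, mem_erase]
            exact ⟨fun h => htu (h ▸ hs.2), fun h => D.irrefl (h ▸ hs.2), hs.1⟩
          have := card_le_card hsub3
          have hc : ((S.erase t).erase u).card = 2 := by
            rw [card_erase_of_mem (mem_erase.mpr ⟨ht.2.1.symm, huS.1⟩), card_erase_of_mem ht.2.2, hS]
          omega
      have hrest' := sum_le_sum hrest
      rw [sum_const, smul_eq_mul, hcard2] at hrest'
      omega
    unfold adjPairs at h6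
    omega
  · -- `u` or `y` is off `S`: no new pair inside `S`
    have hnew : (S ×ˢ S).filter (fun p => (D ⊔ SimpleGraph.edge u y).Adj p.1 p.2) ⊆
        (S ×ˢ S).filter (fun p => D.Adj p.1 p.2) := by
      intro p hp
      rw [mem_filter, adj_sup_edge] at hp
      rw [mem_filter]
      rcases hp.2 with h | ⟨h, -⟩
      · exact ⟨hp.1, h⟩
      · exfalso
        rw [mem_product] at hp
        rcases h with ⟨h1, h2⟩ | ⟨h1, h2⟩
        · exact huS ⟨h1 ▸ hp.1.1, h2 ▸ hp.1.2⟩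
        · exact huS ⟨h2 ▸ hp.1.2, h1 ▸ hp.1.1⟩
    have := card_le_card hnew
    have h8 := hK S hS
    unfold adjPairs at h8
    omega

end C047

end TriangleCap

end PercRepro
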